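import Mathlib
import Summits.PneNP.PneNP.Theorems.SfmBlExistsAux

/-!
# The remainder package with MACHINE-FEASIBLE parameters and RATIONAL thresholds — line «sfm-bl»
(MACHINE-PLAN M3/M5; PROOF-SFM-BL §6 (B))

FRONTIER F-N1c; nothing here bears on P vs NP.

`SfmBl.remainder_package` (prover-2, `SfmBlExistsAux`) instantiates Prop. 7 with the walk exponent
`ℓ = 2^{N+6}` and `t₀ = 2^{N+5}+N` (`N` = number of pieces) and returns the threshold `A₁ = 10(Nρ_R^ℓ+1)`
existentially — enough for the EXISTENCE of a certified signing, but useless for the polynomial-time signing: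
the machine enumerates closed walks of length `ℓ` (cost `≈ #legs·L^{ℓ-1}`) and sub-pairs of spots of size
`≤ t₀` (`2^{t₀}` of them), so `ℓ` and `t₀` must be `O(log N)`, and it compares values of the potential
`F = tr/A₁ + ê/((6/5)(Q₀+1))`, so `A₁` must be RATIONAL (`ρ_R = 100γ_sp(log₂(L/γ_sp)+1)` is not).

`remainder_package_fp` is the same package with
* PARAMETRIC `b, j, t₀` under the three arithmetic side conditions the machine can meet with
  `b, 2^{j+1}, t₀ = O(log N)`:  `N ≤ 2^b`,  `20·N ≤ 2^{2^{j+1}}`,  `2·2^{j+1} + 2b ≤ 10(t₀+1)`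
  (walk exponent `ℓ = 2^{j+2}`, the shape `cutCertified_of_greedy` wants);
* the RATIONAL stand-in `ρ̄ = 2^60/20 ≥ ρ_R` (`sfmBl_rho_le`): threshold `A₁ = 10(N·ρ̄^ℓ + 1) ∈ ℚ`, radius
  `r = √2·ρ̄`, and the four outputs `0 < A₁`, `A₁ ≤ r^ℓ`, `Σ_T tr(A_T^ℓ) ≤ 2^m·A₁/10`, `N·r/2 ≤ 0.32·m`.
`sfmBl_budget_fp` then closes the budget hypothesis `hbudget` of `cutCertified_of_greedy`
(`N·r/2 + Σ_s e_s/30 + (6/5)(Q₀+1) ≤ m` from `Σ_s e_s ≤ 3m`, `Q₀ ≤ 24m·L⁻¹⁰`, `m ≥ 2^60`).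
-/

namespace Summit.PneNP.PneNP.Theorems.SfmBl

open Matrix Finset BigOperators
open Summit.PneNP.PneNP.Theorems.CandCutNorm

/-- **REMAINDER PACKAGE, FP FORM** (parametric `O(log N)` exponents, rational threshold).  See the module
docstring. -/
theorem remainder_package_fp {α β E : Type} [Fintype α] [Fintype β] [DecidableEq α] [DecidableEq β]
    [Fintype E] {m n : ℕ} (src : E → α) (dst : E → β) (out : E → Fin m)
    (hout : ∀ j : Fin m, (Finset.univ.filter fun e => out e = j).card ≤ 3)
    (hdeg₁ : ∀ i, (Finset.univ.filter fun e => src e = i).card ≤ 2 ^ 60)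
    (hdeg₂ : ∀ k, (Finset.univ.filter fun e => dst e = k).card ≤ 2 ^ 60)
    (G : SimpleGraph (α ⊕ β)) [DecidableRel G.Adj] (hG : ∀ e, G.Adj (Sum.inl (src e)) (Sum.inr (dst e)))
    (hGdeg : ∀ x, G.degree x ≤ 2 ^ 60)
    (hn : 1 ≤ n) (hm : 2 ^ 60 * n ≤ m)
    (hN1 : 1 ≤ Fintype.card α + Fintype.card β)
    (hN : ((Fintype.card α : ℝ) + Fintype.card β) ≤ 2 * n + 1 + 6 * m / 2 ^ 60)
    (b j t₀ : ℕ) (hNb : Fintype.card α + Fintype.card β ≤ 2 ^ b)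
    (hj : 20 * (Fintype.card α + Fintype.card β) ≤ 2 ^ (2 ^ (j + 1)))
    (ht : 2 * 2 ^ (j + 1) + 2 * b ≤ 10 * (t₀ + 1))
    (hsparse : ∀ (W₁ : Finset α) (W₂ : Finset β),
      (G.induce {x | Sum.elim (fun i => i ∈ W₁) (fun j => j ∈ W₂) x}).Connected →
      W₁.card + W₂.card ≤ t₀ →
      ((Finset.univ.filter fun e => src e ∈ W₁ ∧ dst e ∈ W₂).card : ℝ)
        ≤ (60 * Real.sqrt (6000 * 2 ^ 60)) * Real.sqrt ((W₁.card : ℝ) * (W₂.card : ℝ)))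
    (M : (Fin m → Bool) → Matrix α β ℝ)
    (hM : ∀ T i k, M T i k = ∑ e ∈ Finset.univ.filter (fun e => src e = i ∧ dst e = k),
      ((boolSign (T (out e)) : ℤ) : ℝ)) :
    0 < 10 * (((Fintype.card α : ℝ) + Fintype.card β) * ((2 : ℝ) ^ 60 / 20) ^ (2 ^ (j + 2)) + 1) ∧
    10 * (((Fintype.card α : ℝ) + Fintype.card β) * ((2 : ℝ) ^ 60 / 20) ^ (2 ^ (j + 2)) + 1)
        ≤ (Real.sqrt 2 * ((2 : ℝ) ^ 60 / 20)) ^ (2 ^ (j + 2)) ∧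
    (∑ T : Fin m → Bool, ((Matrix.fromBlocks (0 : Matrix α α ℝ) (M T) (M T)ᵀ (0 : Matrix β β ℝ))
          ^ (2 ^ (j + 2))).trace
        ≤ 2 ^ m * (10 * (((Fintype.card α : ℝ) + Fintype.card β) * ((2 : ℝ) ^ 60 / 20) ^ (2 ^ (j + 2))
            + 1) / 10)) ∧
    ((Fintype.card α : ℝ) + Fintype.card β) * (Real.sqrt 2 * ((2 : ℝ) ^ 60 / 20)) / 2 ≤ 0.32 * m := by
  classical
  set N : ℕ := Fintype.card α + Fintype.card β with hNdef
  have hNreal : (N : ℝ) = (Fintype.card α : ℝ) + Fintype.card β := by rw [hNdef]; push_cast; ring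
  rw [← hNreal]
  have hL2 : (2 : ℝ) ≤ (2 : ℝ) ^ 60 := by norm_num
  have hL0 : (0 : ℝ) < (2 : ℝ) ^ 60 := by positivity
  have hγ'0 : 0 ≤ Real.sqrt (6000 * 2 ^ 60) := Real.sqrt_nonneg _
  have hγ'L := sfmBl_gamma'_sq_ge
  have hγγ := sfmBl_gamma'_le_gammasp
  have hγsp0 : 0 < 60 * Real.sqrt (6000 * 2 ^ 60) := lt_of_lt_of_le (by norm_num) sfmBl_two_le_gammasp
  have hγspL := sfmBl_gammasp_le_L
  have hρL := sfmBl_rho_le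
  have hρ1 := sfmBl_one_le_rho
  set ρ : ℝ := 100 * ((60 * Real.sqrt (6000 * 2 ^ 60))
      * (Real.logb 2 ((2 : ℝ) ^ 60 / (60 * Real.sqrt (6000 * 2 ^ 60))) + 1)) with hρdef
  set ρb : ℝ := (2 : ℝ) ^ 60 / 20 with hρbdef
  have hρρb : ρ ≤ ρb := by rw [hρdef, hρbdef]; linarith
  have hρ1' : 1 ≤ ρ := by rw [hρdef]; linarith
  have hρ0 : 0 ≤ ρ := by linarith
  have hρb0 : 0 ≤ ρb := hρ0.trans hρρb
  have hρb1 : 1 ≤ ρb := hρ1'.trans hρρb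
  set k : ℕ := 2 ^ (j + 1) with hkdef
  have hℓ : 2 ^ (j + 2) = 2 * k := by rw [hkdef, pow_succ]; ring
  rw [hℓ]
  -- Prop. 7 in the leg model, with the small `t₀`
  have hL₀ : ((2 ^ 60 : ℕ) : ℝ) ≤ (2 : ℝ) ^ 60 := by norm_num
  have h7 := sum_trace_pow_le_legs src dst out hout hdeg₁ hdeg₂ hL2 hL₀ G hG hGdeg hL₀ hγ'0 hγ'L hγγ
    hγsp0 hγspL t₀ hsparse M hM k
  rw [← hρdef, ← hNreal] at h7
  -- the numerics
  have hN0 : (0 : ℝ) ≤ N := Nat.cast_nonneg _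
  have hN1' : (1 : ℝ) ≤ N := by exact_mod_cast hN1
  have hNb' : (N : ℝ) ≤ 2 ^ b := by exact_mod_cast hNb
  have ht' : 2 * k + 2 * b ≤ 10 * (t₀ + 1) := by rw [hkdef]; exact ht
  have hjunk := four_N_sq_pow_mul_inv_le_one hL2 hN0 hNb' ht'
  have hj' : 20 * (N : ℝ) ≤ 2 ^ k := by rw [hkdef]; exact_mod_cast hj
  have h20 := twenty_N_pow_le hρb0 hj'
  have hpow : ρ ^ (2 * k) ≤ ρb ^ (2 * k) := pow_le_pow_left₀ hρ0 hρρb _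
  have hNρb : 1 ≤ (N : ℝ) * ρb ^ (2 * k) := by
    have : (1 : ℝ) ≤ ρb ^ (2 * k) := one_le_pow₀ hρb1
    nlinarith
  refine ⟨by positivity, by linarith, ?_, ?_⟩
  · -- the averaged trace bound
    refine h7.trans ?_
    have h2m : (0 : ℝ) ≤ 2 ^ m := by positivity
    have hj2 := mul_le_mul_of_nonneg_left hjunk h2m
    have hp2 : (2 : ℝ) ^ m * ((N : ℝ) * ρ ^ (2 * k)) ≤ 2 ^ m * ((N : ℝ) * ρb ^ (2 * k)) :=
      mul_le_mul_of_nonneg_left (mul_le_mul_of_nonneg_left hpow hN0) h2m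
    have e : (2 : ℝ) ^ m * (10 * ((N : ℝ) * ρb ^ (2 * k) + 1) / 10)
        = 2 ^ m * ((N : ℝ) * ρb ^ (2 * k)) + 2 ^ m * 1 := by ring
    rw [e]
    exact add_le_add hp2 hj2
  · -- the remainder budget
    have hn' : (2 : ℝ) ^ 60 * n ≤ m := by exact_mod_cast hm
    exact remainder_budget_le hL0 hn hn' (le_of_eq hρbdef) hN0 (by rw [hNreal]; exact hN)

/-- THE BUDGET of `cutCertified_of_greedy` for the FP constants: `N·r/2 ≤ 0.32m`, spot sizes `Σ_s e_s ≤ 3m`,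
`0 ≤ Q₀ ≤ 24m·(2^60)⁻¹⁰`, and `m ≥ 2^60` give `N·r/2 + Σ_s e_s/30 + (6/5)(Q₀+1) ≤ m`. -/
theorem sfmBl_budget_fp {m : ℕ} {Nr S Q₀ : ℝ} (hm : (2 : ℝ) ^ 60 ≤ m) (h1 : Nr ≤ 0.32 * m)
    (hS : S ≤ 3 * m) (hQ₀ : Q₀ ≤ 24 * m * (((2 : ℝ) ^ 60) ^ 10)⁻¹) :
    Nr + S / 30 + 6 / 5 * (Q₀ + 1) ≤ m := by
  have hm0 : (0 : ℝ) ≤ m := le_trans (by positivity) hm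
  have hinv : (((2 : ℝ) ^ 60) ^ 10)⁻¹ ≤ (24000 : ℝ)⁻¹ := by
    apply inv_anti₀ (by norm_num) (by norm_num)
  have hQ : Q₀ ≤ m / 1000 := by
    refine hQ₀.trans ?_
    calc 24 * (m : ℝ) * (((2 : ℝ) ^ 60) ^ 10)⁻¹ ≤ 24 * (m : ℝ) * (24000 : ℝ)⁻¹ :=
          mul_le_mul_of_nonneg_left hinv (by positivity)
      _ = m / 1000 := by ring
  have h2 : (2 : ℝ) ^ 60 ≥ 4 := by norm_num
  linarith

end Summit.PneNP.PneNP.Theorems.SfmBl
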